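import Literature.Probability.LatticeModels.ObservableLimitHolomorphic
import HarnessLib

/-!
# Increments of the FK primitive converge to `Im ∫ g²`

Topic `Literature/Probability/LatticeModels`; an instalment (item B1 of the road recorded in
`Sweep1Proofs.lean`, module docstring §2b) of the discharge programme for crit-ising.S18 /
Smirnov's Theorem 2.2. Smirnov 2010, §5: along a subsequence with `δ^{-1/2} F_δ → g`, the
primitives `H_δ = Im ∫^δ F_δ²` converge to `Im ∫ g²` (up to constants). Tree form
(`tendsto_hw_staircase_core`): along a sequence of meshes with the static estimates of
`ObservableContinuumBounds.lean` from the start, a fixed reference phase `θ₀` and FK primitives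
`(Hw_k, Hb_k)` (`IsFKPrimitive`), the increment of `Hw_k` along the lattice staircase inscribed
in a rectangle with ordered corners `z, w` (horizontal leg then vertical leg) converges to
`-(κ²/√2) · Im (θ₀² · (∫_{z.re}^{w.re} g²(x + i z.im) dx + i ∫_{z.im}^{w.im} g²(w.re + i y) dy))`
(the wedge integral of `g²`). Ingredients: the white increment formula across an edge
(`hw_increment_eq`, Smirnov's Remark 3.7 for white squares: `Hw(u+e_k) - Hw(u) =
-(κ²/√2) Im(i^k (θ₀ F(e))²)`), horizontal edge values `F = √δ · u(mesh point)`
(`obsAt_eq_sqrt_mul_scaledObs`), vertical edge values within `O(δ√δ)` of horizontal ones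
(`exists_cross_bound`), uniform convergence of `u_k² → g²` (`TendstoUniformlyOn.pow_two`), and
the Riemann sums of `ScalingLimitRiemannSums.lean` along rows and columns (`tendsto_row_sum`,
`tendsto_col_sum`, `tendsto_floor_mul`). Everything is proved.

## References

* S. Smirnov, Ann. of Math. 172 (2010) 1435–1467, Remark 3.7 and §5 — bib key `Smirnov2010`.
-/

noncomputable section

namespace Literature.Probability.LatticeModels

open Filter _root_.Topology Metric Set Finset Complex

/-! ### The white increment formula -/

section Increment

variable {E : DiscreteDobrushin} [Fintype (meshDomain E.Ω E.δ)] {hE : E.IsZdAdmissible} {Hw Hb : Site 2 → ℝ}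

/-- **White increment of the FK primitive across an edge** (Smirnov 2010, Remark 3.7, white
squares): for an FK primitive `(Hw, Hb)` and an edge `e = cSrc (u, k)` such that `e` and
`(u + e_k, k + 1)` are interior,
`Hw (u + e_k) - Hw u = -(κ²/√2) · Im (i^k (refPhase · F(e))²)`. [cite: Smirnov2010, Remark 3.7] -/
theorem hw_increment_eq (h : IsFKPrimitive E hE Hw Hb)
    (hA : ((discreteDomainGraph E.Ω E.δ).induce E.zdArcA).Preconnected) {u : Site 2} {k : Fin 4}
    (h0 : E.IsInteriorEdge u k) (h1 : E.IsInteriorEdge (u + cornerUnit k) (k + 1)) :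
    Hw (u + cornerUnit k) - Hw u = -((eighthPhase 1).re ^ 2 / Real.sqrt 2) *
      (I ^ (k : ℕ) * (refPhase (DiscreteDobrushin.startCorner hE) * fkIsingObservable E criticalFKIsingParam (cSrc (u, k))) ^ 2).im := by
  set c₀ := DiscreteDobrushin.startCorner hE with hc₀
  set G : MedialVertex → ℂ := fun z => refPhase c₀ * fkIsingObservable E criticalFKIsingParam z with hG
  have p0 := h (u, k) h0.inner
  have p1 := h (u + cornerUnit k, k + 1) (by
    change E.IsInnerFace (faceAt (u + cornerUnit k) (k + 1)); rw [faceAt_add_unit_succ]; exact h0.inner)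
  simp only [cFace] at p0 p1
  rw [faceAt_add_unit_succ] at p1
  have d0 : dartFlux E hE (u, k) = fluxConst c₀ * cornerFlux G (u, k) := dartFlux_eq_source hE hA h0
  have d1 : dartFlux E hE (u + cornerUnit k, k + 1) = fluxConst c₀ * cornerFlux G (u + cornerUnit k, k + 1) :=
    dartFlux_eq_source hE hA h1
  have s1 : IsSHolAt G (u + cornerUnit k, k + 1) :=
    isSHolAt_refPhase hE hA h1 (by rw [show k + 1 + 1 = k + 2 by omega]; exact h0.reverse)
  have wI := cornerFlux_sub_cornerFlux_eq_im G u k s1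
  have hfc : fluxConst c₀ = (eighthPhase 1).re ^ 2 := fluxConst_eq c₀
  have hwhite : Hw (u + cornerUnit k) - Hw u = fluxConst c₀ * (cornerFlux G (u, k) - cornerFlux G (u + cornerUnit k, k + 1)) := by
    rw [mul_sub]; linarith [d0, d1]
  rw [hwhite, wI, hfc]
  simp only [hG]
  ring

end Increment

/-! ### Products of uniformly convergent sequences -/

/-- Squares of a uniformly convergent sequence converge uniformly on a set where the limit is
bounded. [folklore] -/
theorem TendstoUniformlyOn.pow_two {K : Set ℂ} {u : ℕ → ℂ → ℂ} {g : ℂ → ℂ} (hu : TendstoUniformlyOn u g atTop K)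
    {M : ℝ} (hM : ∀ z ∈ K, ‖g z‖ ≤ M) :
    TendstoUniformlyOn (fun k z => u k z ^ 2) (fun z => g z ^ 2) atTop K := by
  rw [Metric.tendstoUniformlyOn_iff] at hu ⊢
  intro ε hε
  set M' := max M 0 with hM'
  have hM'0 : 0 ≤ M' := le_max_right _ _
  have hη : 0 < min 1 (ε / (2 * M' + 2)) := lt_min one_pos (by positivity)
  filter_upwards [hu _ hη] with k hk z hz
  have h := hk z hz
  rw [dist_eq_norm] at h ⊢
  rw [lt_min_iff] at h
  have hgz : ‖g z‖ ≤ M' := (hM z hz).trans (le_max_left _ _)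
  have e : g z ^ 2 - u k z ^ 2 = (g z - u k z) * (g z + u k z) := by ring
  rw [e, norm_mul]
  have h2 : ‖g z + u k z‖ ≤ 2 * M' + 1 := by
    calc ‖g z + u k z‖ = ‖2 * g z - (g z - u k z)‖ := by ring_nf
      _ ≤ ‖2 * g z‖ + ‖g z - u k z‖ := norm_sub_le _ _
      _ ≤ 2 * M' + 1 := by rw [norm_mul, Complex.norm_two]; linarith [h.1]
  calc ‖g z - u k z‖ * ‖g z + u k z‖ ≤ ε / (2 * M' + 2) * (2 * M' + 1) := by
        gcongr; exact h.2.le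
    _ < ε := by
        rw [div_mul_eq_mul_div, div_lt_iff₀ (by positivity)]; nlinarith

/-! ### Riemann sums along the rows and columns of the grid of a rectangle -/

section Grid

variable {K : Set ℂ} (hK : IsCompact K) {v : ℕ → ℂ → ℂ} {G : ℂ → ℂ} (hG : ContinuousOn G K)
  (hv : TendstoUniformlyOn v G atTop K) {s : ℕ → ℝ} (hs0 : ∀ k, 0 < s k) (hs : Tendsto s atTop (𝓝 0))
  {z w : ℂ} (hre : z.re ≤ w.re) (him : z.im ≤ w.im) {r : ℝ} (hr : 0 < r)
  (hKR : cthickening r (Rectangle z w) ⊆ K) (hsr : ∀ k, 3 * s k ≤ r)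

include hs0 hs in
/-- `⌊ℓ/s_k⌋ s_k → ℓ` and `(⌊ℓ/s_k⌋ + 1) s_k → ℓ`, packaged for `N = m` or `m + 1`. [folklore] -/
theorem tendsto_floor_mul {ℓ : ℝ} (hℓ : 0 ≤ ℓ) {N : ℕ → ℕ}
    (hN : ∀ k, N k = ⌊ℓ / s k⌋₊ ∨ N k = ⌊ℓ / s k⌋₊ + 1) :
    Tendsto (fun k => (N k : ℝ) * s k) atTop (𝓝 ℓ) := by
  have hfl : ∀ k, (⌊ℓ / s k⌋₊ : ℝ) * s k ≤ ℓ ∧ ℓ < (⌊ℓ / s k⌋₊ + 1) * s k := fun k => floor_mul_le_of_le hℓ (hs0 k)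
  have h1 : Tendsto (fun k => (⌊ℓ / s k⌋₊ : ℝ) * s k) atTop (𝓝 ℓ) := by
    refine tendsto_of_tendsto_of_tendsto_of_le_of_le (g := fun k => ℓ - s k) (h := fun k => ℓ) ?_ tendsto_const_nhds
      (fun k => by have := (hfl k).2; simp only; nlinarith) (fun k => (hfl k).1)
    simpa using (tendsto_const_nhds (x := ℓ)).sub hs
  have h2 : Tendsto (fun k => ((⌊ℓ / s k⌋₊ : ℝ) + 1) * s k) atTop (𝓝 ℓ) := by
    have : Tendsto (fun k => (⌊ℓ / s k⌋₊ : ℝ) * s k + s k) atTop (𝓝 (ℓ + 0)) := h1.add hs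
    rw [add_zero] at this
    exact this.congr fun k => by ring
  refine tendsto_of_tendsto_of_tendsto_of_le_of_le h1 h2 (fun k => ?_) (fun k => ?_)
  · rcases hN k with h' | h' <;> simp only [h'] <;> push_cast <;> nlinarith [hs0 k]
  · rcases hN k with h' | h' <;> simp only [h'] <;> push_cast <;> nlinarith [hs0 k]

include hK hG hv hs0 hs hre him hr hKR hsr in
/-- **Riemann sums of `v_k` along a row of the grid converge to the row integral of `G`.** [folklore] -/
theorem tendsto_row_sum (N : ℕ → ℕ) (jr : ℕ → ℤ) (h : ℝ) (hh : h ∈ Icc z.im w.im)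
    (hN : ∀ k, N k = ⌊(w.re - z.re) / s k⌋₊ ∨ N k = ⌊(w.re - z.re) / s k⌋₊ + 1)
    (hjr : ∀ k, -1 ≤ jr k ∧ jr k ≤ ⌊(w.im - z.im) / s k⌋₊ + 1) (hjh : ∀ k, |z.im + s k * jr k - h| ≤ s k) :
    Tendsto (fun k => (s k : ℂ) * ∑ t ∈ Finset.range (N k), v k (meshPoint (s k) (vtx (nearestSite (s k) z) t (jr k)))) atTop
      (𝓝 (∫ x : ℝ in z.re..w.re, G (x + h * I))) := by
  have hℓ : 0 ≤ w.re - z.re := by linarith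
  have hNℓ := tendsto_floor_mul hs0 hs hℓ hN
  have key := tendsto_mul_sum_of_tendstoUniformlyOn hK hG hv hs0 hs hℓ hNℓ (p := (h : ℂ) * I) (v := 1)
    (by simp) (a₀ := z.re) (m₀ := r / 2) (by positivity)
    ((row_image_subset_cthickening z w hr hh hre).trans hKR) (C := 2) (by norm_num)
    (P := fun k t => meshPoint (s k) (vtx (nearestSite (s k) z) t (jr k))) (fun k t ht => ?_) (fun k t ht => ?_)
  · have e : (fun x : ℝ => G ((h : ℂ) * I + (x : ℂ) * 1)) = fun x : ℝ => G (x + h * I) := by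
      funext x; ring_nf
    rw [show z.re + (w.re - z.re) = w.re by ring, e] at key
    exact key
  · exact hKR (cthickening_mono (hsr k) _ (meshPoint_vtx_mem_cthickening (hs0 k) z w hre him (by omega)
      (by rcases hN k with h' | h' <;> omega) (hjr k).1 (hjr k).2))
  · calc _ ≤ s k + |z.im + s k * jr k - h| := dist_meshPoint_vtx_row_le (hs0 k) z t (jr k) h
      _ ≤ s k + s k := by gcongr; exact hjh k
      _ = 2 * s k := by ring

include hK hG hv hs0 hs hre him hr hKR hsr in
/-- **Riemann sums of `v_k` along a column of the grid converge to the column integral of `G`.** [folklore] -/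
theorem tendsto_col_sum (N : ℕ → ℕ) (ic : ℕ → ℤ) (h : ℝ) (hh : h ∈ Icc z.re w.re)
    (hN : ∀ k, N k = ⌊(w.im - z.im) / s k⌋₊ ∨ N k = ⌊(w.im - z.im) / s k⌋₊ + 1)
    (hic : ∀ k, -1 ≤ ic k ∧ ic k ≤ ⌊(w.re - z.re) / s k⌋₊ + 1) (hih : ∀ k, |z.re + s k * ic k - h| ≤ s k) :
    Tendsto (fun k => (s k : ℂ) * ∑ t ∈ Finset.range (N k), v k (meshPoint (s k) (vtx (nearestSite (s k) z) (ic k) t))) atTop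
      (𝓝 (∫ y : ℝ in z.im..w.im, G (h + y * I))) := by
  have hℓ : 0 ≤ w.im - z.im := by linarith
  have hNℓ := tendsto_floor_mul hs0 hs hℓ hN
  have key := tendsto_mul_sum_of_tendstoUniformlyOn hK hG hv hs0 hs hℓ hNℓ (p := (h : ℂ)) (v := I)
    (by simp) (a₀ := z.im) (m₀ := r / 2) (by positivity)
    ((col_image_subset_cthickening z w hr hh him).trans hKR) (C := 2) (by norm_num)
    (P := fun k t => meshPoint (s k) (vtx (nearestSite (s k) z) (ic k) t)) (fun k t ht => ?_) (fun k t ht => ?_)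
  · rw [show z.im + (w.im - z.im) = w.im by ring] at key
    exact key
  · exact hKR (cthickening_mono (hsr k) _ (meshPoint_vtx_mem_cthickening (hs0 k) z w hre him (hic k).1 (hic k).2
      (by omega) (by rcases hN k with h' | h' <;> omega)))
  · calc _ ≤ s k + |z.re + s k * ic k - h| := dist_meshPoint_vtx_col_le (hs0 k) z (ic k) t h
      _ ≤ s k + s k := by gcongr; exact hih k
      _ = 2 * s k := by ring

end Grid

/-! ### The increment of `Hw` along a lattice staircase converges -/

/-- `vtx b (i + 1) j = vtx b i j + e₀`. [folklore] -/
theorem vtx_add_one_left (b : Site 2) (i j : ℤ) : vtx b (i + 1) j = vtx b i j + cornerUnit 0 := by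
  simp only [vtx, add_smul, one_smul]; abel

/-- `vtx b i (j + 1) = vtx b i j + e₁`. [folklore] -/
theorem vtx_add_one_right (b : Site 2) (i j : ℤ) : vtx b i (j + 1) = vtx b i j + cornerUnit 1 := by
  simp only [vtx, add_smul, one_smul]; abel

/-- `vtx b 0 0 = b`. [folklore] -/
theorem vtx_zero_zero (b : Site 2) : vtx b 0 0 = b := by simp [vtx]

section Core

variable {D : RandomPlanarGeometry.DobrushinDomain} {E : ℝ → DiscreteDobrushin}

/-- **Increments of the FK primitive converge to `-(κ²/√2) Im (θ₀² ∫ g²)`** (Smirnov 2010, §5: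
"`H_δ = Im ∫^δ F_δ²` converges to `Im ∫ f²`"), core form: along a sequence of meshes with the
static estimates from the start, a fixed reference phase `θ₀`, FK primitives `(Hw_k, Hb_k)`, and
`δ_k^{-1/2} F_{δ_k} → g` uniformly on a compact neighbourhood of the rectangle with ordered corners
`z`, `w`: the increment of `Hw_k` along the lattice staircase from the site nearest to `z`
(horizontal leg, then vertical leg) to the grid vertex nearest to `w` converges to
`-(κ²/√2) Im (θ₀² (∫_{z.re}^{w.re} g²(x + i z.im) dx + i ∫_{z.im}^{w.im} g²(w.re + i y) dy))`.
[cite: Smirnov2010, Remark 3.7 and §5] -/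
theorem tendsto_hw_staircase_core (hDE : IsDiscretisation D E) {s : ℕ → ℝ} (hs0 : ∀ k, 0 < s k)
    (hs : Tendsto s atTop (𝓝 0)) {g : ℂ → ℂ} {z w : ℂ} (hre : z.re ≤ w.re) (him : z.im ≤ w.im)
    {K : Set ℂ} (hK : IsCompact K) (hg : ContinuousOn g K) {r : ℝ} (hr : 0 < r)
    (hKR : cthickening r (Rectangle z w) ⊆ K)
    (hconv : TendstoUniformlyOn (scaledObs E s) g atTop K)
    (H : ∀ k, ObsHyp (E (s k))) (hsr : ∀ k, 3 * s k ≤ r)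
    {ρ : ℝ} (hbulk : ∀ k, ∀ x y : Site 2, meshPoint (s k) x ∈ K →
      dist (meshPoint (s k) y) (meshPoint (s k) x) ≤ ρ → ∀ e : Fin 4, (E (s k)).IsInteriorEdge y e)
    (hsρ : ∀ k, 6 * s k ≤ ρ)
    {L : ℝ} (hcross : ∀ k, ∀ x : Site 2, meshPoint (s k) x ∈ K →
      ‖obsAt (E (s k)) (H k).adm (cSrc (x, 1)) - obsAt (E (s k)) (H k).adm (cSrc (x, 0))‖ ≤ L * s k * Real.sqrt (s k))
    {M : ℝ} (hM : ∀ k, ∀ x : Site 2, meshPoint (s k) x ∈ K → ∀ i : Fin 4, (i = 0 ∨ i = 1) →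
      ‖obsAt (E (s k)) (H k).adm (cSrc (x, i))‖ ≤ M * Real.sqrt (s k))
    (Hw Hb : ℕ → Site 2 → ℝ)
    (hprim : ∀ k, @IsFKPrimitive (E (s k)) ((E (s k)).admFintype (H k).adm) (H k).adm (Hw k) (Hb k))
    {θ₀ : ℂ} (hθ : ∀ k, refPhase (DiscreteDobrushin.startCorner (H k).adm) = θ₀) :
    Tendsto (fun k => Hw k (vtx (nearestSite (s k) z) (⌊(w.re - z.re) / s k⌋₊) (⌊(w.im - z.im) / s k⌋₊)) -
        Hw k (nearestSite (s k) z)) atTop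
      (𝓝 (-((eighthPhase 1).re ^ 2 / Real.sqrt 2) *
        (θ₀ ^ 2 * ((∫ x : ℝ in z.re..w.re, g (x + z.im * I) ^ 2) +
          I * ∫ y : ℝ in z.im..w.im, g (w.re + y * I) ^ 2)).im)) := by
  -- notation
  set b : ℕ → Site 2 := fun k => nearestSite (s k) z with hb
  set m : ℕ → ℕ := fun k => ⌊(w.re - z.re) / s k⌋₊ with hm
  set n : ℕ → ℕ := fun k => ⌊(w.im - z.im) / s k⌋₊ with hn
  set F : ∀ k : ℕ, MedialVertex → ℂ := fun k => obsAt (E (s k)) (H k).adm with hF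
  set u := scaledObs E s with hu
  set κ : ℝ := (eighthPhase 1).re ^ 2 / Real.sqrt 2 with hκ
  have hfloorx : ∀ k, (m k : ℝ) * s k ≤ w.re - z.re ∧ w.re - z.re < (m k + 1) * s k :=
    fun k => floor_mul_le_of_le (by linarith) (hs0 k)
  have hfloory : ∀ k, (n k : ℝ) * s k ≤ w.im - z.im ∧ w.im - z.im < (n k + 1) * s k :=
    fun k => floor_mul_le_of_le (by linarith) (hs0 k)
  -- grid points are in `K`, edges near them interior
  have hgridK : ∀ k (i j : ℤ), -1 ≤ i → i ≤ m k + 1 → -1 ≤ j → j ≤ n k + 1 → meshPoint (s k) (vtx (b k) i j) ∈ K := by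
    intro k i j hi hi' hj hj'
    exact hKR (cthickening_mono (hsr k) _ (meshPoint_vtx_mem_cthickening (hs0 k) z w hre him hi hi' hj hj'))
  have hint : ∀ k (i j : ℤ), -1 ≤ i → i ≤ m k + 1 → -1 ≤ j → j ≤ n k + 1 →
      ∀ y : Site 2, DiscreteDobrushin.supNear (vtx (b k) i j) 3 y → ∀ e : Fin 4, (E (s k)).IsInteriorEdge y e := by
    intro k i j hi hi' hj hj' y hy e
    refine hbulk k _ y (hgridK k i j hi hi' hj hj') ?_ e
    have := DiscreteDobrushin.dist_meshPoint_le_of_supNear (hs0 k).le hy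
    push_cast at this; linarith [hsρ k]
  have hhor : ∀ k (x : Site 2), F k (cSrc (x, 0)) = (Real.sqrt (s k) : ℂ) * u k (meshPoint (s k) x) :=
    fun k x => obsAt_eq_sqrt_mul_scaledObs hDE (hs0 k) (H k).adm x
  have hsq : ∀ k, ((Real.sqrt (s k) : ℂ)) ^ 2 = (s k : ℂ) := fun k => by
    rw [← Complex.ofReal_pow, Real.sq_sqrt (hs0 k).le]
  -- the increment formula along the two legs
  have hincr : ∀ k (y : Site 2) (e : Fin 4), (∀ y', DiscreteDobrushin.supNear y 3 y' → ∀ e', (E (s k)).IsInteriorEdge y' e') →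
      Hw k (y + cornerUnit e) - Hw k y = -κ * (I ^ (e : ℕ) * (θ₀ * F k (cSrc (y, e))) ^ 2).im := by
    intro k y e hy
    letI := (E (s k)).admFintype (H k).adm
    have h0 : (E (s k)).IsInteriorEdge y e := hy y (DiscreteDobrushin.supNear_self y (by norm_num)) e
    have h1 : (E (s k)).IsInteriorEdge (y + cornerUnit e) (e + 1) :=
      hy _ (by intro i; fin_cases i <;> fin_cases e <;> simp [cornerUnit]) _
    have := hw_increment_eq (hprim k) (H k).arcA h0 h1
    rw [hθ k] at this
    rw [this, hκ]
    rfl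
  -- telescoping along the horizontal leg `(t, 0)`, `t < m`, and the vertical leg `(m, t)`, `t < n`
  have htel : ∀ k, Hw k (vtx (b k) (m k) (n k)) - Hw k (b k) =
      ∑ t ∈ Finset.range (m k), (Hw k (vtx (b k) ((t : ℤ) + 1) 0) - Hw k (vtx (b k) t 0)) +
        ∑ t ∈ Finset.range (n k), (Hw k (vtx (b k) (m k) ((t : ℤ) + 1)) - Hw k (vtx (b k) (m k) t)) := by
    intro k
    have h1 := Finset.sum_range_sub (fun t : ℕ => Hw k (vtx (b k) t 0)) (m k)
    have h2 := Finset.sum_range_sub (fun t : ℕ => Hw k (vtx (b k) (m k) t)) (n k)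
    simp only [Nat.cast_succ, Nat.cast_zero] at h1 h2
    rw [h1, h2, vtx_zero_zero]
    ring
  -- horizontal leg in terms of `u`
  have hlegH : ∀ k, ∑ t ∈ Finset.range (m k), (Hw k (vtx (b k) ((t : ℤ) + 1) 0) - Hw k (vtx (b k) t 0)) =
      -κ * (θ₀ ^ 2 * ((s k : ℂ) * ∑ t ∈ Finset.range (m k), u k (meshPoint (s k) (vtx (b k) t 0)) ^ 2)).im := by
    intro k
    have hterm : ∀ t ∈ Finset.range (m k), Hw k (vtx (b k) ((t : ℤ) + 1) 0) - Hw k (vtx (b k) t 0) =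
        -κ * (θ₀ ^ 2 * ((s k : ℂ) * u k (meshPoint (s k) (vtx (b k) t 0)) ^ 2)).im := by
      intro t ht
      have htm := Finset.mem_range.1 ht
      rw [vtx_add_one_left, hincr k _ 0 (hint k t 0 (by omega) (by omega) (by omega) (by omega))]
      have e : I ^ ((0 : Fin 4) : ℕ) * (θ₀ * F k (cSrc (vtx (b k) t 0, 0))) ^ 2 =
          θ₀ ^ 2 * ((s k : ℂ) * u k (meshPoint (s k) (vtx (b k) t 0)) ^ 2) := by
        rw [Fin.val_zero, pow_zero, one_mul, mul_pow, hhor, mul_pow, hsq]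
      rw [e]
    rw [Finset.sum_congr rfl hterm, ← Finset.mul_sum]
    congr 1
    rw [← Complex.im_sum]
    congr 1
    rw [Finset.mul_sum, Finset.mul_sum]
  -- vertical leg in terms of `u` plus an error
  set err : ℕ → ℂ := fun k => ∑ t ∈ Finset.range (n k),
    (F k (cSrc (vtx (b k) (m k) t, 1)) ^ 2 - F k (cSrc (vtx (b k) (m k) t, 0)) ^ 2) with herr
  have hlegV : ∀ k, ∑ t ∈ Finset.range (n k), (Hw k (vtx (b k) (m k) ((t : ℤ) + 1)) - Hw k (vtx (b k) (m k) t)) =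
      -κ * (I * θ₀ ^ 2 * ((s k : ℂ) * ∑ t ∈ Finset.range (n k), u k (meshPoint (s k) (vtx (b k) (m k) t)) ^ 2 + err k)).im := by
    intro k
    have hterm : ∀ t ∈ Finset.range (n k), Hw k (vtx (b k) (m k) ((t : ℤ) + 1)) - Hw k (vtx (b k) (m k) t) =
        -κ * (I * θ₀ ^ 2 * F k (cSrc (vtx (b k) (m k) t, 1)) ^ 2).im := by
      intro t ht
      have htn := Finset.mem_range.1 ht
      rw [vtx_add_one_right, hincr k _ 1 (hint k (m k) t (by omega) (by omega) (by omega) (by omega))]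
      have e : I ^ ((1 : Fin 4) : ℕ) * (θ₀ * F k (cSrc (vtx (b k) (m k) t, 1))) ^ 2 =
          I * θ₀ ^ 2 * F k (cSrc (vtx (b k) (m k) t, 1)) ^ 2 := by
        rw [Fin.val_one, pow_one]; ring
      rw [e]
    rw [Finset.sum_congr rfl hterm]
    have e : (s k : ℂ) * ∑ t ∈ Finset.range (n k), u k (meshPoint (s k) (vtx (b k) (m k) t)) ^ 2 + err k =
        ∑ t ∈ Finset.range (n k), F k (cSrc (vtx (b k) (m k) t, 1)) ^ 2 := by
      rw [herr, Finset.mul_sum, ← Finset.sum_add_distrib]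
      refine Finset.sum_congr rfl fun t _ => ?_
      rw [hhor, mul_pow, hsq]; ring
    rw [e, ← Finset.mul_sum]
    congr 1
    rw [← Complex.im_sum]
    congr 1
    rw [Finset.mul_sum]
  -- uniform convergence of `u²` to `g²`
  obtain ⟨Mg, hMg⟩ := hK.exists_bound_of_continuousOn hg
  have hconv2 : TendstoUniformlyOn (fun k ζ => u k ζ ^ 2) (fun ζ => g ζ ^ 2) atTop K := TendstoUniformlyOn.pow_two hconv hMg
  have hg2 : ContinuousOn (fun ζ => g ζ ^ 2) K := hg.pow 2
  -- limits of the two Riemann sums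
  have LH : Tendsto (fun k => (s k : ℂ) * ∑ t ∈ Finset.range (m k), u k (meshPoint (s k) (vtx (b k) t 0)) ^ 2) atTop
      (𝓝 (∫ x : ℝ in z.re..w.re, g (x + z.im * I) ^ 2)) := by
    have := tendsto_row_sum hK hg2 hconv2 hs0 hs hre him hr hKR hsr m (fun _ => 0) z.im ⟨le_rfl, him⟩
      (fun k => Or.inl rfl) (fun k => ⟨by omega, by omega⟩) (fun k => by simp [(hs0 k).le])
    simpa using this
  have LV : Tendsto (fun k => (s k : ℂ) * ∑ t ∈ Finset.range (n k), u k (meshPoint (s k) (vtx (b k) (m k) t)) ^ 2) atTop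
      (𝓝 (∫ y : ℝ in z.im..w.im, g (w.re + y * I) ^ 2)) := by
    have := tendsto_col_sum hK hg2 hconv2 hs0 hs hre him hr hKR hsr n (fun k => m k) w.re ⟨hre, le_rfl⟩
      (fun k => Or.inl rfl) (fun k => ⟨by omega, by simp only [hm]; omega⟩)
      (fun k => by have h' := hfloorx k; simp only [hm] at h' ⊢; rw [abs_le]; push_cast; constructor <;> nlinarith [h'.1, h'.2])
    simpa using this
  -- the error tends to zero: `‖err k‖ ≤ n · (L s √s) (2 M √s) = 2 L M (n s) s`
  have Lerr : Tendsto err atTop (𝓝 0) := by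
    rw [tendsto_zero_iff_norm_tendsto_zero]
    have hbound : ∀ k, ‖err k‖ ≤ 2 * (|L| * |M|) * ((n k : ℝ) * s k) * s k := by
      intro k
      have hsk := hs0 k
      have hsq' : Real.sqrt (s k) * Real.sqrt (s k) = s k := Real.mul_self_sqrt hsk.le
      calc ‖err k‖ ≤ ∑ t ∈ Finset.range (n k), ‖F k (cSrc (vtx (b k) (m k) t, 1)) ^ 2 - F k (cSrc (vtx (b k) (m k) t, 0)) ^ 2‖ :=
            norm_sum_le _ _
        _ ≤ ∑ t ∈ Finset.range (n k), (|L| * s k * Real.sqrt (s k)) * (2 * (|M| * Real.sqrt (s k))) := by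
            refine Finset.sum_le_sum fun t ht => ?_
            have htn := Finset.mem_range.1 ht
            have hyK := hgridK k (m k) t (by omega) (by omega) (by omega) (by omega)
            set a := F k (cSrc (vtx (b k) (m k) t, 1))
            set a' := F k (cSrc (vtx (b k) (m k) t, 0))
            have h1 : ‖a - a'‖ ≤ |L| * s k * Real.sqrt (s k) :=
              (hcross k _ hyK).trans (by gcongr; exact le_abs_self L)
            have h2 : ‖a‖ ≤ |M| * Real.sqrt (s k) := (hM k _ hyK 1 (Or.inr rfl)).trans (by gcongr; exact le_abs_self M)
            have h3 : ‖a'‖ ≤ |M| * Real.sqrt (s k) := (hM k _ hyK 0 (Or.inl rfl)).trans (by gcongr; exact le_abs_self M)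
            rw [show a ^ 2 - a' ^ 2 = (a - a') * (a + a') by ring, norm_mul]
            refine mul_le_mul h1 ((norm_add_le _ _).trans (by linarith)) (norm_nonneg _) (by positivity)
        _ = 2 * (|L| * |M|) * ((n k : ℝ) * s k) * s k := by
            rw [Finset.sum_const, Finset.card_range, nsmul_eq_mul]
            calc (n k : ℝ) * (|L| * s k * Real.sqrt (s k) * (2 * (|M| * Real.sqrt (s k))))
                = 2 * (|L| * |M|) * ((n k : ℝ) * s k) * (Real.sqrt (s k) * Real.sqrt (s k)) := by ring
              _ = _ := by rw [hsq']
    have hnN : Tendsto (fun k => (n k : ℝ) * s k) atTop (𝓝 (w.im - z.im)) :=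
      tendsto_floor_mul hs0 hs (ℓ := w.im - z.im) (by linarith) (N := n) fun k => Or.inl rfl
    have hlim : Tendsto (fun k => 2 * (|L| * |M|) * ((n k : ℝ) * s k) * s k) atTop (𝓝 0) := by
      have := (hnN.const_mul (2 * (|L| * |M|))).mul hs
      rw [mul_zero] at this
      exact this
    exact squeeze_zero (fun k => norm_nonneg _) hbound hlim
  -- assemble
  have hmain : Tendsto (fun k => -κ * (θ₀ ^ 2 * ((s k : ℂ) * ∑ t ∈ Finset.range (m k), u k (meshPoint (s k) (vtx (b k) t 0)) ^ 2)).im +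
      -κ * (I * θ₀ ^ 2 * ((s k : ℂ) * ∑ t ∈ Finset.range (n k), u k (meshPoint (s k) (vtx (b k) (m k) t)) ^ 2 + err k)).im) atTop
      (𝓝 (-κ * (θ₀ ^ 2 * ∫ x : ℝ in z.re..w.re, g (x + z.im * I) ^ 2).im +
        -κ * (I * θ₀ ^ 2 * ((∫ y : ℝ in z.im..w.im, g (w.re + y * I) ^ 2) + 0)).im)) := by
    refine Tendsto.add ?_ ?_
    · exact ((Complex.continuous_im.tendsto _).comp (LH.const_mul (θ₀ ^ 2))).const_mul (-κ)
    · exact ((Complex.continuous_im.tendsto _).comp ((LV.add Lerr).const_mul (I * θ₀ ^ 2))).const_mul (-κ)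
  rw [add_zero] at hmain
  have e : -κ * (θ₀ ^ 2 * ∫ x : ℝ in z.re..w.re, g (x + z.im * I) ^ 2).im +
      -κ * (I * θ₀ ^ 2 * ∫ y : ℝ in z.im..w.im, g (w.re + y * I) ^ 2).im =
      -κ * (θ₀ ^ 2 * ((∫ x : ℝ in z.re..w.re, g (x + z.im * I) ^ 2) + I * ∫ y : ℝ in z.im..w.im, g (w.re + y * I) ^ 2)).im := by
    rw [mul_add, Complex.add_im, mul_add, ← mul_assoc, mul_comm (θ₀ ^ 2) I]
  rw [e] at hmain
  refine hmain.congr fun k => ?_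
  rw [htel k, hlegH k, hlegV k]

end Core

end Literature.Probability.LatticeModels
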